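import Mathlib
import HarnessLib
import Summits.HubbardSuperconductivity.HubbardSuperconductivity.Theorems.ThermalWedgeTwPureThermalBoundGcMinimizers
import Summits.HubbardSuperconductivity.HubbardSuperconductivity.Theorems.ThermalWedgeTwPureThermalBoundMixingLemmas

/-!
# Route `ThermalWedge`, item `stmt-HubbardSuperconductivity-1702` (`TwPureThermalBound`):
# the canonical ground-state energy is below the grand-canonical supporting line (GC MIXING)

Support file (`--supports stmt-HubbardSuperconductivity-1702`; no definition; the route file is NOT
imported). Notation: `E_L(N) = groundEnergyAt (fermionTorusGraph 2 L) 1 U N`, `G_L(μ) = E₀(hubbardTorusWith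
2 L 1 U μ) = min_N (E_L(N) − μN)`, `g(μ) = lim_L G_L(μ)/L²` (exists: `stub_torusGcEnergyDensityLimit`).

**Theorem `ptbm_canonical_upper`.** If `ρ₀ ∈ [1/2, 1]` and `μ₀` satisfies the one-sided secant
conditions `g(μ₀−τ) − g(μ₀) ≤ ρ₀τ ≤ g(μ₀) − g(μ₀+τ)` (`0 < τ ≤ 1`; i.e. `μ₀` minimises `−g − ρ₀·`
locally — a density jump at `μ₀` is allowed, no differentiability), then for `|N_L − ρ₀L²| ≤ 2`:
`E_L(N_L) − μ₀N_L ≤ (g(μ₀) + ε)L²` eventually in `L`. Proof: fix `τ ∝ ε` and a scale `M ≥ 16/τ`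
with `|G_M/M² − g| ≤ τ²` at `μ₀, μ₀ ± τ`; minimizing sectors `N_a ≤ N_b` of `G_M` at `μ₀ ∓ τ` have
densities `≤ ρ₀ + 2τ`, `≥ ρ₀ − 2τ` and energies `≤ M²g(μ₀) + μ₀N_x + 3τM²`; for `L = nM + r` tile
`nM × nM` by `M × M` blocks with `m` rows at `N_a` and `n − m` rows at `N_b` (`ptbm_rowMixing`), fill the
margin with nothing (`groundEnergyAt_square_fill`), choose `m` by `ptbm_exists_rowCount` so that the total
is within `2τL² + 2ML + 2` of `N_L`, and walk the rest (`ptbm_walk`). Error `O(τ)L² + O(ML) + O(1)`.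
Ruelle, *Statistical Mechanics: Rigorous Results* (1969), §3.4 (classical analogue). [folklore]
-/

set_option linter.dupNamespace false

noncomputable section

namespace Summit.HubbardSuperconductivity.HubbardSuperconductivity.Theorems

open Literature.MathematicalPhysics.QuantumLattice Literature.Probability.LatticeModels Matrix Finset Filter
open Literature.MathematicalPhysics.QuantumLattice.ThermodynamicLimit
open scoped ComplexOrder Topology

/-! ### The main estimate -/

/-- **GC mixing: the canonical sector energy is below the grand-canonical supporting line.** See the
module docstring. Hypotheses: `U ≥ 0`; `g` is the pointwise limit of `G_L(μ)/L²`; `μ₀` satisfies the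
one-sided secant (optimality) conditions for the density `ρ₀ ∈ [1/2, 1]`; `|N_L − ρ₀L²| ≤ 2`.
Conclusion: `E_L(N_L) − μ₀N_L ≤ (g(μ₀) + ε)L²` eventually. (Ruelle (1969) §3.4; equivalence of
ensembles at `T = 0` by mixing two grand-canonical phases.) [folklore] -/
theorem ptbm_canonical_upper (U : ℝ) (hU : 0 ≤ U) (μ₀ ρ₀ : ℝ) (hρ₁ : 1 / 2 ≤ ρ₀) (hρ₂ : ρ₀ ≤ 1)
    (g : ℝ → ℝ)
    (hg : ∀ μ : ℝ, Tendsto (fun L : ℕ => (hubbardTorusWith 2 L 1 U μ).groundEnergy / (L : ℝ) ^ 2)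
      atTop (𝓝 (g μ)))
    (hLft : ∀ τ : ℝ, 0 < τ → τ ≤ 1 → g (μ₀ - τ) - g μ₀ ≤ ρ₀ * τ)
    (hRgt : ∀ τ : ℝ, 0 < τ → τ ≤ 1 → ρ₀ * τ ≤ g μ₀ - g (μ₀ + τ))
    (Nt : ℕ → ℕ) (hNt : ∀ L : ℕ, |(Nt L : ℝ) - ρ₀ * (L : ℝ) ^ 2| ≤ 2) :
    ∀ ε : ℝ, 0 < ε → ∃ L₀ : ℕ, ∀ L : ℕ, L₀ ≤ L →
      groundEnergyAt (fermionTorusGraph 2 L) 1 U (Nt L) - μ₀ * (Nt L) ≤ (g μ₀ + ε) * (L : ℝ) ^ 2 := by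
  intro ε hε
  -- constants (`c₁` = walk cost per particle, `A` = coefficient of `τ` in the error)
  set c₁ : ℝ := 144 * (2 + |U|) with hc₁
  have hc₁0 : 0 ≤ c₁ := by positivity
  have hcμ : 0 ≤ c₁ + |μ₀| := by positivity
  set A : ℝ := 4 + 2 * (c₁ + |μ₀|) with hA
  have hA0 : 0 < A := by positivity
  obtain ⟨τ, hτ0, hτ1, hτ16, hτA⟩ : ∃ τ : ℝ, 0 < τ ∧ τ ≤ 1 ∧ τ ≤ 1 / 16 ∧ τ * A ≤ ε / 2 := by
    refine ⟨min (1 / 16) (ε / (2 * A)), lt_min (by norm_num) (by positivity),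
      (min_le_left _ _).trans (by norm_num), min_le_left _ _, ?_⟩
    have h : min (1 / 16) (ε / (2 * A)) ≤ ε / (2 * A) := min_le_right _ _
    rw [le_div_iff₀ (by positivity)] at h
    linarith
  -- the scale `M`: `G_M/M²` within `τ²` of `g` at the three chemical potentials
  have hτ2 : 0 < τ ^ 2 := by positivity
  have hclose : ∀ μ : ℝ, ∃ M₁ : ℕ, ∀ M : ℕ, M₁ ≤ M →
      |(hubbardTorusWith 2 M 1 U μ).groundEnergy / (M : ℝ) ^ 2 - g μ| < τ ^ 2 := by
    intro μ
    obtain ⟨M₁, hM₁⟩ := Metric.tendsto_atTop.mp (hg μ) (τ ^ 2) hτ2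
    exact ⟨M₁, fun M hM => by simpa [Real.dist_eq] using hM₁ M hM⟩
  obtain ⟨Mm, hMm⟩ := hclose (μ₀ - τ)
  obtain ⟨Mz, hMz⟩ := hclose μ₀
  obtain ⟨Mp, hMp⟩ := hclose (μ₀ + τ)
  obtain ⟨M, hM1, hMa, hMb, hMc, hMd⟩ : ∃ M : ℕ, 1 ≤ M ∧ Mm ≤ M ∧ Mz ≤ M ∧ Mp ≤ M ∧ ⌈16 / τ⌉₊ ≤ M :=
    ⟨max (max Mm Mz) (max Mp (⌈16 / τ⌉₊ + 1)),
      le_trans (by omega) (le_trans (le_max_right _ _) (le_max_right _ _)),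
      le_trans (le_max_left _ _) (le_max_left _ _), le_trans (le_max_right _ _) (le_max_left _ _),
      le_trans (le_max_left _ _) (le_max_right _ _),
      le_trans (Nat.le_succ _) (le_trans (le_max_right _ _) (le_max_right _ _))⟩
  have hMm' := hMm M hMa
  have hMz' := hMz M hMb
  have hMp' := hMp M hMc
  clear hMm hMz hMp hclose
  have hMpos : (0 : ℝ) < M := by exact_mod_cast hM1
  have hM2pos : (0 : ℝ) < (M : ℝ) ^ 2 := by positivity
  have hM2nn : (0 : ℝ) ≤ (M : ℝ) ^ 2 := hM2pos.le
  have hM16 : 16 ≤ τ * M := by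
    have h1 : (16 : ℝ) / τ ≤ M := (Nat.le_ceil _).trans (by exact_mod_cast hMd)
    rw [div_le_iff₀ hτ0] at h1
    linarith only [h1]
  -- unpack closeness: `M²(g − τ²) ≤ G_M ≤ M²(g + τ²)`
  have unpack : ∀ {μ : ℝ}, |(hubbardTorusWith 2 M 1 U μ).groundEnergy / (M : ℝ) ^ 2 - g μ| < τ ^ 2 →
      (hubbardTorusWith 2 M 1 U μ).groundEnergy ≤ (M : ℝ) ^ 2 * (g μ + τ ^ 2) ∧
        (M : ℝ) ^ 2 * (g μ - τ ^ 2) ≤ (hubbardTorusWith 2 M 1 U μ).groundEnergy := by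
    intro μ h
    rw [abs_lt] at h
    obtain ⟨h1, h2⟩ := h
    rw [sub_lt_iff_lt_add, div_lt_iff₀ hM2pos] at h2
    rw [lt_sub_iff_add_lt, lt_div_iff₀ hM2pos] at h1
    constructor
    · linarith only [h2]
    · linarith only [h1]
  obtain ⟨hGm_le, -⟩ := unpack hMm'
  obtain ⟨hGz_le, hGz_ge⟩ := unpack hMz'
  obtain ⟨hGp_le, -⟩ := unpack hMp'
  clear hMm' hMz' hMp' unpack
  -- the two minimizing sectors at scale `M`
  obtain ⟨Na, hNa2, hNa⟩ := ptbm_gc_exists_minimizer M U (μ₀ - τ)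
  obtain ⟨Nb, hNb2, hNb⟩ := ptbm_gc_exists_minimizer M U (μ₀ + τ)
  have hab : Na ≤ Nb := ptbm_minimizer_mono M U (by linarith only [hτ0] : μ₀ - τ < μ₀ + τ) hNa2 hNb2 hNa hNb
  have hsL := hLft τ hτ0 hτ1
  have hsR := hRgt τ hτ0 hτ1
  have hNa0 : (0 : ℝ) ≤ Na := Nat.cast_nonneg _
  have hNb2R : (Nb : ℝ) ≤ 2 * (M : ℝ) ^ 2 := by exact_mod_cast hNb2
  -- densities
  have hNa_le : (Na : ℝ) ≤ (ρ₀ + 2 * τ) * (M : ℝ) ^ 2 := by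
    have h := ptbm_mul_minimizer_le M U (μ₀ - τ) (h := τ) hNa2 hNa
    rw [sub_add_cancel] at h
    have h5 : (M : ℝ) ^ 2 * (g (μ₀ - τ) - g μ₀) ≤ (M : ℝ) ^ 2 * (ρ₀ * τ) :=
      mul_le_mul_of_nonneg_left hsL hM2nn
    -- `τ Na ≤ G(μ₀−τ) − G(μ₀) ≤ M²(ρ₀τ + 2τ²)`
    have : τ * (Na : ℝ) ≤ τ * ((ρ₀ + 2 * τ) * (M : ℝ) ^ 2) := by linarith only [h, h5, hGm_le, hGz_ge]
    exact le_of_mul_le_mul_left this hτ0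
  have hNb_ge : (ρ₀ - 2 * τ) * (M : ℝ) ^ 2 ≤ Nb := by
    have h := ptbm_le_mul_minimizer M U (μ₀ + τ) (h := τ) hNb2 hNb
    rw [add_sub_cancel_right] at h
    have h5 : (M : ℝ) ^ 2 * (ρ₀ * τ) ≤ (M : ℝ) ^ 2 * (g μ₀ - g (μ₀ + τ)) :=
      mul_le_mul_of_nonneg_left hsR hM2nn
    have : τ * ((ρ₀ - 2 * τ) * (M : ℝ) ^ 2) ≤ τ * (Nb : ℝ) := by linarith only [h, h5, hGz_ge, hGp_le]
    exact le_of_mul_le_mul_left this hτ0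
  -- energies of the two sectors: `E_M(N_x) ≤ M² g(μ₀) + μ₀ N_x + 3τM²`
  have hτsq : (M : ℝ) ^ 2 * τ ^ 2 ≤ (M : ℝ) ^ 2 * τ := by
    apply mul_le_mul_of_nonneg_left _ hM2nn; nlinarith only [hτ0, hτ1]
  have hρτM : (M : ℝ) ^ 2 * (ρ₀ * τ) ≤ (M : ℝ) ^ 2 * τ := by
    apply mul_le_mul_of_nonneg_left _ hM2nn; nlinarith only [hτ0, hρ₂]
  have hEa : groundEnergyAt (fermionRectTorusGraph M M) 1 U Na ≤
      (M : ℝ) ^ 2 * g μ₀ + μ₀ * Na + 3 * τ * (M : ℝ) ^ 2 := by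
    rw [← groundEnergyAt_fermionTorusGraph_two, ptbm_minimizer_energy M U (μ₀ - τ) hNa]
    have h1 : (M : ℝ) ^ 2 * g (μ₀ - τ) ≤ (M : ℝ) ^ 2 * (g μ₀ + ρ₀ * τ) :=
      mul_le_mul_of_nonneg_left (by linarith only [hsL]) hM2nn
    have h2 : 0 ≤ τ * (Na : ℝ) := by positivity
    have h3 : 0 ≤ τ * (M : ℝ) ^ 2 := by positivity
    linarith only [hGm_le, h1, h2, h3, hτsq, hρτM]
  have hEb : groundEnergyAt (fermionRectTorusGraph M M) 1 U Nb ≤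
      (M : ℝ) ^ 2 * g μ₀ + μ₀ * Nb + 3 * τ * (M : ℝ) ^ 2 := by
    rw [← groundEnergyAt_fermionTorusGraph_two, ptbm_minimizer_energy M U (μ₀ + τ) hNb]
    have hρτ0 : 0 ≤ ρ₀ * τ := by positivity
    have h1 : (M : ℝ) ^ 2 * g (μ₀ + τ) ≤ (M : ℝ) ^ 2 * g μ₀ :=
      mul_le_mul_of_nonneg_left (by linarith only [hsR, hρτ0]) hM2nn
    have h2 : τ * (Nb : ℝ) ≤ τ * (2 * (M : ℝ) ^ 2) := mul_le_mul_of_nonneg_left hNb2R hτ0.le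
    linarith only [hGp_le, h1, h2, hτsq]
  clear hGm_le hGz_le hGz_ge hGp_le hNa hNb hsL hsR
  -- the threshold `L₀`
  set B : ℝ := 2 * (M : ℝ) * (c₁ + |μ₀|) + 2 * (M : ℝ) * (8 + U + |g μ₀|) + 16 + 2 * (c₁ + |μ₀|) with hB
  have hB0 : 0 ≤ B := by positivity
  refine ⟨max (64 * M) (⌈2 * B / ε⌉₊ + 8), fun L hL => ?_⟩
  have hL64 : 64 * M ≤ L := le_trans (le_max_left _ _) hL
  have hLc : ⌈2 * B / ε⌉₊ + 8 ≤ L := le_trans (le_max_right _ _) hL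
  clear hL
  have hL8 : 8 ≤ L := by omega
  have hLB : 2 * B / ε ≤ L := by
    have h1 : (⌈2 * B / ε⌉₊ : ℝ) ≤ L := by exact_mod_cast (by omega : ⌈2 * B / ε⌉₊ ≤ L)
    exact (Nat.le_ceil _).trans h1
  have hLpos : (0 : ℝ) < L := by exact_mod_cast (by omega : 0 < L)
  have hL2pos : (0 : ℝ) < (L : ℝ) ^ 2 := by positivity
  have hML : (M : ℝ) ≤ L := by exact_mod_cast (by omega : M ≤ L)
  have hL64R : (64 : ℝ) * M ≤ L := by exact_mod_cast hL64
  have hL8R : (8 : ℝ) ≤ L := by exact_mod_cast hL8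
  have hL1 : (1 : ℝ) ≤ L := by linarith only [hL8R]
  -- Euclidean division `L = nM + r`
  have hdiv : L / M * M + L % M = L := Nat.div_add_mod' L M
  have hn64 : 64 ≤ L / M := (Nat.le_div_iff_mul_le hM1).2 hL64
  have hrM : L % M < M := Nat.mod_lt L hM1
  generalize hndef : L / M = n at hdiv hn64
  generalize hrdef : L % M = r at hdiv hrM
  clear hndef hrdef
  have hn1 : 1 ≤ n := le_trans (by norm_num) hn64
  obtain ⟨k, hk⟩ : ∃ k, n = k + 1 := ⟨n - 1, by omega⟩
  -- real forms
  have hnR : (n : ℝ) * M + r = L := by exact_mod_cast hdiv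
  have hrR : (r : ℝ) < M := by exact_mod_cast hrM
  obtain ⟨hr0, hn0⟩ : (0 : ℝ) ≤ r ∧ (0 : ℝ) ≤ n := ⟨Nat.cast_nonneg _, Nat.cast_nonneg _⟩
  have hnM0 : (0 : ℝ) ≤ (n : ℝ) * M := by positivity
  have hnMle : (n : ℝ) * M ≤ L := by linarith only [hnR, hr0]
  have hgap : (L : ℝ) ^ 2 - ((n : ℝ) * M) ^ 2 ≤ 2 * M * L := by
    have e : (L : ℝ) ^ 2 - ((n : ℝ) * M) ^ 2 = r * (L + n * M) := by rw [← hnR]; ring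
    rw [e]
    calc (r : ℝ) * (L + n * M) ≤ M * (L + n * M) :=
          mul_le_mul_of_nonneg_right hrR.le (by positivity)
      _ ≤ M * (2 * L) := mul_le_mul_of_nonneg_left (by linarith only [hnMle]) hMpos.le
      _ = 2 * M * L := by ring
  have hsq : ((n : ℝ) * M) ^ 2 ≤ (L : ℝ) ^ 2 := pow_le_pow_left₀ hnM0 hnMle 2
  have hnM2 : (L : ℝ) ^ 2 - 2 * M * L ≤ ((n : ℝ) * M) ^ 2 := by linarith only [hgap]
  -- the row count
  obtain ⟨m, hmn, hT1, hT2⟩ := ptbm_exists_rowCount n Na Nb (Nt L) hab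
  obtain ⟨T, hTdef⟩ : ∃ T : ℕ, T = n * (m * Na + (n - m) * Nb) := ⟨_, rfl⟩
  rw [← hTdef] at hT1 hT2
  -- `|T − N_L| ≤ 2τL² + 2ML + 2`
  have hNtL := hNt L
  rw [abs_le] at hNtL
  obtain ⟨hNt1, hNt2⟩ := hNtL
  have hTNa : (n : ℝ) * (n * Na) ≤ (ρ₀ + 2 * τ) * (L : ℝ) ^ 2 := by
    have hρ2τ : 0 ≤ ρ₀ + 2 * τ := by positivity
    calc (n : ℝ) * (n * Na) = (n : ℝ) ^ 2 * Na := by ring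
      _ ≤ (n : ℝ) ^ 2 * ((ρ₀ + 2 * τ) * (M : ℝ) ^ 2) := by gcongr
      _ = (ρ₀ + 2 * τ) * ((n : ℝ) * M) ^ 2 := by ring
      _ ≤ (ρ₀ + 2 * τ) * (L : ℝ) ^ 2 := mul_le_mul_of_nonneg_left hsq hρ2τ
  have hρτ : 0 ≤ ρ₀ - 2 * τ := by linarith only [hρ₁, hτ16]
  have hTNb : (ρ₀ - 2 * τ) * (L : ℝ) ^ 2 - 2 * M * L ≤ (n : ℝ) * (n * Nb) := by
    have h1 : (ρ₀ - 2 * τ) * ((n : ℝ) * M) ^ 2 ≤ (n : ℝ) * (n * Nb) := by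
      have h := mul_le_mul_of_nonneg_left hNb_ge (sq_nonneg (n : ℝ))
      have e1 : (n : ℝ) ^ 2 * ((ρ₀ - 2 * τ) * (M : ℝ) ^ 2) = (ρ₀ - 2 * τ) * ((n : ℝ) * M) ^ 2 := by ring
      have e2 : (n : ℝ) ^ 2 * (Nb : ℝ) = (n : ℝ) * (n * Nb) := by ring
      rw [e1, e2] at h
      exact h
    have h2 : (ρ₀ - 2 * τ) * ((L : ℝ) ^ 2 - 2 * M * L) ≤ (ρ₀ - 2 * τ) * ((n : ℝ) * M) ^ 2 :=
      mul_le_mul_of_nonneg_left hnM2 hρτ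
    have h3 : (ρ₀ - 2 * τ) * (2 * M * L) ≤ 1 * (2 * M * L) :=
      mul_le_mul_of_nonneg_right (by linarith only [hρ₂, hτ0]) (by positivity)
    linarith only [h1, h2, h3]
  have hTR : (T : ℝ) = n * (m * Na + ((n - m : ℕ) : ℝ) * Nb) := by rw [hTdef]; push_cast; ring
  have hstepR : (n : ℝ) * ((Nb : ℝ) - Na) ≤ 2 * M * L := by
    have : (Nb : ℝ) - Na ≤ 2 * (M : ℝ) ^ 2 := by linarith only [hNb2R, hNa0]
    calc (n : ℝ) * ((Nb : ℝ) - Na) ≤ n * (2 * (M : ℝ) ^ 2) := mul_le_mul_of_nonneg_left this hn0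
      _ = 2 * M * (n * M) := by ring
      _ ≤ 2 * M * L := mul_le_mul_of_nonneg_left hnMle (by positivity)
  have hT1R : (T : ℝ) ≤ Nt L + 2 * M * L + (2 * τ * (L : ℝ) ^ 2 + 2) := by
    have e1 : ((n * (Nb - Na) : ℕ) : ℝ) = n * ((Nb : ℝ) - Na) := by push_cast [hab]; ring
    have e2 : ((n * (n * Na) - Nt L : ℕ) : ℝ) ≤ max 0 ((n : ℝ) * (n * Na) - Nt L) := by
      rcases le_total (n * (n * Na)) (Nt L) with hle | hle
      · rw [Nat.sub_eq_zero_of_le hle]; simp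
      · push_cast [hle]; exact le_max_right _ _
    have e3 : max 0 ((n : ℝ) * (n * Na) - Nt L) ≤ 2 * τ * (L : ℝ) ^ 2 + 2 := by
      refine max_le (by positivity) ?_
      linarith only [hTNa, hNt1]
    have h' : (T : ℝ) ≤ (Nt L : ℝ) + ((n * (Nb - Na) : ℕ) : ℝ) + ((n * (n * Na) - Nt L : ℕ) : ℝ) := by
      exact_mod_cast hT1
    rw [e1] at h'
    linarith only [h', e2, e3, hstepR]
  have hT2R : (Nt L : ℝ) ≤ T + (2 * τ * (L : ℝ) ^ 2 + 2 * M * L + 2) := by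
    have e2 : ((Nt L - n * (n * Nb) : ℕ) : ℝ) ≤ max 0 ((Nt L : ℝ) - n * (n * Nb)) := by
      rcases le_total (Nt L) (n * (n * Nb)) with hle | hle
      · rw [Nat.sub_eq_zero_of_le hle]; simp
      · push_cast [hle]; exact le_max_right _ _
    have e3 : max 0 ((Nt L : ℝ) - n * (n * Nb)) ≤ 2 * τ * (L : ℝ) ^ 2 + 2 * M * L + 2 := by
      refine max_le (by positivity) ?_
      linarith only [hTNb, hNt2]
    have h' : (Nt L : ℝ) ≤ (T : ℝ) + ((Nt L - n * (n * Nb) : ℕ) : ℝ) := by exact_mod_cast hT2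
    linarith only [h', e2, e3]
  have hTdist : |(Nt L : ℝ) - T| ≤ 2 * τ * (L : ℝ) ^ 2 + 2 * M * L + 2 := by
    rw [abs_le]; constructor
    · linarith only [hT1R]
    · linarith only [hT2R]
  clear hT1 hT2 hT1R hT2R hTNa hTNb hstepR
  -- density window for the walk: both `T` and `N_L` in `[L²/4, 3L²/2]`
  have hML32 : 2 * (M : ℝ) * L ≤ (L : ℝ) ^ 2 / 32 := by
    have := mul_le_mul_of_nonneg_right hL64R hLpos.le
    nlinarith only [this]
  have h2L : (2 : ℝ) ≤ (L : ℝ) ^ 2 / 32 := by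
    have := mul_le_mul hL8R hL8R (by norm_num) hLpos.le
    nlinarith only [this]
  have hτL : 2 * τ * (L : ℝ) ^ 2 ≤ (L : ℝ) ^ 2 / 8 := by
    have := mul_le_mul_of_nonneg_right hτ16 hL2pos.le
    linarith only [this]
  have hwin1 : (L : ℝ) ^ 2 ≤ 4 * (Nt L : ℝ) := by nlinarith only [hNt1, hρ₁, h2L, hL2pos]
  have hwin2 : 2 * (Nt L : ℝ) ≤ 3 * (L : ℝ) ^ 2 := by nlinarith only [hNt2, hρ₂, h2L, hL2pos]
  have hwin3 : (L : ℝ) ^ 2 ≤ 4 * (T : ℝ) := by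
    have := (abs_le.1 hTdist).2
    nlinarith only [this, hNt1, hρ₁, h2L, hML32, hτL, hL2pos]
  have hwin4 : 2 * (T : ℝ) ≤ 3 * (L : ℝ) ^ 2 := by
    have := (abs_le.1 hTdist).1
    nlinarith only [this, hNt2, hρ₂, h2L, hML32, hτL, hL2pos]
  have hw1 : L ^ 2 ≤ 4 * Nt L := by exact_mod_cast hwin1
  have hw2 : 2 * Nt L ≤ 3 * L ^ 2 := by exact_mod_cast hwin2
  have hw3 : L ^ 2 ≤ 4 * T := by exact_mod_cast hwin3
  have hw4 : 2 * T ≤ 3 * L ^ 2 := by exact_mod_cast hwin4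
  -- (1) walk from `T` to `N_L`
  have hwalk := ptbm_walk L U hw3 hw4 hw1 hw2
  clear hw1 hw2 hw3 hw4 hwin1 hwin2 hwin3 hwin4
  -- (2) tiling at scale `nM`
  have hm' : m ≤ k + 1 := hk ▸ hmn
  have hNa2' : Na ≤ 2 * (M * M) := by simpa only [sq] using hNa2
  have hNb2' : Nb ≤ 2 * (M * M) := by simpa only [sq] using hNb2
  have htile := ptbm_rowMixing M k m hm' U hNa2' hNb2'
  rw [← hk, ← hTdef] at htile
  -- (3) fill from `nM` to `L = nM + r`
  have hT2nM : T ≤ 2 * (n * M * (n * M)) := by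
    have : m * Na + (n - m) * Nb ≤ n * (2 * (M * M)) := by
      calc m * Na + (n - m) * Nb ≤ m * (2 * (M * M)) + (n - m) * (2 * (M * M)) := by gcongr
        _ = n * (2 * (M * M)) := by rw [← Nat.add_mul]; congr 1; omega
    calc T = n * (m * Na + (n - m) * Nb) := hTdef
      _ ≤ n * (n * (2 * (M * M))) := Nat.mul_le_mul_left n this
      _ = 2 * (n * M * (n * M)) := by ring
  have hfill := groundEnergyAt_square_fill (n * M) r 1 hU (N := T) (NB := 0) hT2nM (Nat.zero_le _)
  rw [add_zero, hdiv, abs_one] at hfill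
  -- pass to real numbers and make every energy an opaque real
  rw [groundEnergyAt_fermionTorusGraph_two L 1 U (Nt L)]
  have hkR : (k : ℝ) = n - 1 := by
    have : ((k + 1 : ℕ) : ℝ) = n := by rw [← hk]
    push_cast at this; linarith only [this]
  have hnmR : ((n - m : ℕ) : ℝ) = n - m := by push_cast [hmn]; ring
  rw [hnmR] at htile hTR
  push_cast at hfill
  have e1 : (r : ℝ) * ((n : ℝ) * M) + r * ((n : ℝ) * M + r) = (L : ℝ) ^ 2 - ((n : ℝ) * M) ^ 2 := by
    rw [← hnR]; ring
  rw [e1] at hfill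
  generalize groundEnergyAt (fermionRectTorusGraph M M) 1 U Na = Ea at hEa htile
  generalize groundEnergyAt (fermionRectTorusGraph M M) 1 U Nb = Eb at hEb htile
  generalize groundEnergyAt (fermionRectTorusGraph (n * M) (n * M)) 1 U T = EnT at htile hfill
  generalize groundEnergyAt (fermionRectTorusGraph L L) 1 U T = ELT at hfill hwalk
  generalize groundEnergyAt (fermionRectTorusGraph L L) 1 U (Nt L) = ELN at hwalk ⊢
  generalize g μ₀ = g0 at hEa hEb hB ⊢
  -- real arithmetic from here on
  have htileR : EnT ≤ (n : ℝ) * (m * Ea + ((n : ℝ) - m) * Eb) + 16 * M * (n : ℝ) ^ 2 := by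
    have hMn : (0 : ℝ) ≤ 16 * M * n := by positivity
    have : (16 : ℝ) * M * k * ((k : ℝ) + 1) ≤ 16 * M * (n : ℝ) ^ 2 := by
      rw [hkR]
      have e : (16 : ℝ) * M * (n - 1) * (n - 1 + 1) = 16 * M * (n : ℝ) ^ 2 - 16 * M * n := by ring
      rw [e]; linarith only [hMn]
    linarith only [htile, this]
  have hm0 : (0 : ℝ) ≤ m := Nat.cast_nonneg _
  have hnm0 : (0 : ℝ) ≤ (n : ℝ) - m := by
    have : (m : ℝ) ≤ n := by exact_mod_cast hmn
    linarith only [this]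
  have hblocks : (n : ℝ) * (m * Ea + ((n : ℝ) - m) * Eb) ≤
      ((n : ℝ) * M) ^ 2 * g0 + μ₀ * T + 3 * τ * ((n : ℝ) * M) ^ 2 := by
    have h1 : (m : ℝ) * Ea ≤ m * ((M : ℝ) ^ 2 * g0 + μ₀ * Na + 3 * τ * (M : ℝ) ^ 2) :=
      mul_le_mul_of_nonneg_left hEa hm0
    have h2 : ((n : ℝ) - m) * Eb ≤ ((n : ℝ) - m) * ((M : ℝ) ^ 2 * g0 + μ₀ * Nb + 3 * τ * (M : ℝ) ^ 2) :=
      mul_le_mul_of_nonneg_left hEb hnm0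
    have h3 := mul_le_mul_of_nonneg_left (add_le_add h1 h2) hn0
    have e : (n : ℝ) * (m * ((M : ℝ) ^ 2 * g0 + μ₀ * Na + 3 * τ * (M : ℝ) ^ 2) +
        ((n : ℝ) - m) * ((M : ℝ) ^ 2 * g0 + μ₀ * Nb + 3 * τ * (M : ℝ) ^ 2)) =
        ((n : ℝ) * M) ^ 2 * g0 + μ₀ * T + 3 * τ * ((n : ℝ) * M) ^ 2 := by
      rw [hTR]; ring
    linarith only [h3, e]
  -- `(nM)² g ≤ L² g + (L² − (nM)²)|g|`
  have hgsplit : ((n : ℝ) * M) ^ 2 * g0 ≤ (L : ℝ) ^ 2 * g0 + 2 * M * L * |g0| := by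
    have h0 : 0 ≤ (L : ℝ) ^ 2 - ((n : ℝ) * M) ^ 2 := by linarith only [hsq]
    have e : ((n : ℝ) * M) ^ 2 * g0 = (L : ℝ) ^ 2 * g0 - ((L : ℝ) ^ 2 - ((n : ℝ) * M) ^ 2) * g0 := by ring
    rw [e]
    have h1 : -(((L : ℝ) ^ 2 - ((n : ℝ) * M) ^ 2) * g0) ≤ ((L : ℝ) ^ 2 - ((n : ℝ) * M) ^ 2) * |g0| := by
      rw [← mul_neg]; exact mul_le_mul_of_nonneg_left (neg_le_abs _) h0
    have h2 : ((L : ℝ) ^ 2 - ((n : ℝ) * M) ^ 2) * |g0| ≤ 2 * M * L * |g0| :=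
      mul_le_mul_of_nonneg_right hgap (abs_nonneg _)
    linarith only [h1, h2]
  -- fill error in real form
  have hfillR : ELT ≤ EnT + (8 + U) * (2 * M * L) + 16 * L := by
    have h3 : (8 * 1 + U) * ((L : ℝ) ^ 2 - ((n : ℝ) * M) ^ 2) ≤ (8 + U) * (2 * M * L) := by
      rw [show (8 : ℝ) * 1 + U = 8 + U by ring]
      exact mul_le_mul_of_nonneg_left hgap (by linarith only [hU])
    have h4 : (8 : ℝ) * 1 * (2 * ((n : ℝ) * M) + r) ≤ 16 * L := by linarith only [hnR, hnMle]
    linarith only [hfill, h3, h4]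
  -- `μ₀ T ≤ μ₀ N_L + |μ₀| |T − N_L|`
  have hμT : μ₀ * (T : ℝ) ≤ μ₀ * Nt L + |μ₀| * (2 * τ * (L : ℝ) ^ 2 + 2 * M * L + 2) := by
    have h1 : μ₀ * ((T : ℝ) - Nt L) ≤ |μ₀| * |(Nt L : ℝ) - T| := by
      rw [abs_sub_comm]; exact (le_abs_self _).trans (by rw [abs_mul])
    have h2 : |μ₀| * |(Nt L : ℝ) - T| ≤ |μ₀| * (2 * τ * (L : ℝ) ^ 2 + 2 * M * L + 2) :=
      mul_le_mul_of_nonneg_left hTdist (abs_nonneg μ₀)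
    linarith only [h1, h2]
  -- the walk error
  have hwalkR : ELN ≤ ELT + c₁ * (2 * τ * (L : ℝ) ^ 2 + 2 * M * L + 2) := by
    have : c₁ * |(Nt L : ℝ) - T| ≤ c₁ * (2 * τ * (L : ℝ) ^ 2 + 2 * M * L + 2) :=
      mul_le_mul_of_nonneg_left hTdist hc₁0
    linarith only [hwalk, this]
  -- collect: main term + τ-terms + (M L)-terms + constants
  have htotal : ELN - μ₀ * Nt L ≤ (L : ℝ) ^ 2 * g0 + τ * A * (L : ℝ) ^ 2 + B * L := by
    have hτn : 3 * τ * ((n : ℝ) * M) ^ 2 ≤ 3 * τ * (L : ℝ) ^ 2 :=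
      mul_le_mul_of_nonneg_left hsq (by positivity)
    have hconst : 2 * (c₁ + |μ₀|) * 1 ≤ 2 * (c₁ + |μ₀|) * L :=
      mul_le_mul_of_nonneg_left hL1 (by positivity)
    -- the tiling seams: `16 M n² ≤ τ L²` since `16 ≤ τ M` and `(nM)² ≤ L²`
    have hseam : 16 * (M : ℝ) * (n : ℝ) ^ 2 ≤ τ * (L : ℝ) ^ 2 := by
      have h1 : 16 * ((M : ℝ) * (n : ℝ) ^ 2) ≤ τ * M * ((M : ℝ) * (n : ℝ) ^ 2) :=
        mul_le_mul_of_nonneg_right hM16 (by positivity)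
      have h2 : τ * ((n : ℝ) * M) ^ 2 ≤ τ * (L : ℝ) ^ 2 := mul_le_mul_of_nonneg_left hsq hτ0.le
      have e : τ * M * ((M : ℝ) * (n : ℝ) ^ 2) = τ * ((n : ℝ) * M) ^ 2 := by ring
      linarith only [h1, h2, e]
    have eA : τ * A * (L : ℝ) ^ 2 = 3 * τ * (L : ℝ) ^ 2 + τ * (L : ℝ) ^ 2 +
        (c₁ + |μ₀|) * (2 * τ * (L : ℝ) ^ 2) := by
      rw [hA]; ring
    have eB : B * L = (c₁ + |μ₀|) * (2 * M * L) + (8 + U + |g0|) * (2 * M * L) + 16 * L +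
        2 * (c₁ + |μ₀|) * L := by rw [hB]; ring
    linarith only [hwalkR, hfillR, htileR, hblocks, hgsplit, hμT, hτn, hconst, hseam, eA, eB]
  -- `τ A ≤ ε/2` and `B L ≤ (ε/2) L²`
  have hBL : B * (L : ℝ) ≤ ε / 2 * (L : ℝ) ^ 2 := by
    have h1 : 2 * B ≤ ε * L := by
      rw [div_le_iff₀ hε] at hLB; linarith only [hLB]
    have h2 := mul_le_mul_of_nonneg_right h1 hLpos.le
    have e : ε * (L : ℝ) * L = 2 * (ε / 2 * (L : ℝ) ^ 2) := by ring
    linarith only [h2, e]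
  have hτAL : τ * A * (L : ℝ) ^ 2 ≤ ε / 2 * (L : ℝ) ^ 2 := mul_le_mul_of_nonneg_right hτA hL2pos.le
  linarith only [htotal, hBL, hτAL]

end Summit.HubbardSuperconductivity.HubbardSuperconductivity.Theorems

end
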